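import Summits.QuantumFields.QCD.Theorems.SpectralDefectExtinctionWegnerEstimateSketchDefs
import Summits.QuantumFields.QCD.Theorems.SpectralDefectExtinctionWegnerEstimatePortRigidityFaces
import Literature.MathematicalPhysics.QuantumLattice.GrassmannIntegralProofs

/-!
# Crux `WegnerEstimate` (item stmt-QuantumFields-8966), line `Sketch` gen 3: geometry and spin algebra of the 2-edge junk

Bridge toward `badPort_eq_zero` / `not_portSmallBall` (sibling `…WegnerEstimateBadPortVanishes.lean`): the junk
witnesses of the appended gen-3 section of `…WegnerEstimateSketchDefs.lean` (`junkSpinor`, `junkSite₁/₂`,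
`junkFace₁/₂/₃`, `IsJunkSite`) satisfy
* spin algebra: `γ₀ s = s`, `fwdHop 0 · s = 0`, and `P_-^0 (fwdHop 1 − fwdHop 2) s = 0` (anticommutation);
* lattice geometry (all `R ≥ 1`, linear integer arithmetic): the two junk sites lie in the port domain, no link
  joins them, no site of `box (R−1)` is or neighbours a junk site, no face is a junk site or has one behind it, and
  the forward incidences face → junk site are exactly `f₂ + e₀ = z₁`, `f₁ + e₁ = z₁`, `f₃ + e₀ = z₂`, `f₁ + e₂ = z₂`;
* product fields `v(y) = col(y) ⊗ s`: the hop sum of `Γ₅ D_W` factorises direction by direction, and a link current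
  vanishes when the colour amplitude vanishes at either endpoint.
Written by the line lead (prover-line-stmt-QuantumFields-8966-c3-0).
-/

noncomputable section

namespace Summit.QuantumFields.QCD.Cruxes.WegnerEstimate.ResolventCell

open scoped Matrix BigOperators
open Literature.MathematicalPhysics.QuantumLattice Literature.MathematicalPhysics.QuantumFieldTheory
  Literature.Probability.LatticeModels
open Matrix Complex

/-! ### Spin algebra of the junk spinor -/

/-- `γ₀ s = s`. -/
theorem euclideanGamma_zero_mulVec_junkSpinor : (euclideanGamma 0) *ᵥ junkSpinor = junkSpinor := by
  rw [euclideanGamma_zero, junkSpinor]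
  ext i
  fin_cases i <;> simp [Matrix.mulVec, dotProduct, Fin.sum_univ_four]

/-- `(1 − γ₀) s = 0`: the junk spinor lies in `ran P_+^0 = ker P_-^0`. -/
theorem one_sub_euclideanGamma_zero_mulVec_junkSpinor :
    ((1 : Matrix (Fin 4) (Fin 4) ℂ) - euclideanGamma 0) *ᵥ junkSpinor = 0 := by
  rw [Matrix.sub_mulVec, Matrix.one_mulVec, euclideanGamma_zero_mulVec_junkSpinor, sub_self]

/-- The direction-`0` forward hop kills the junk spinor: `fwdHop 0 · s = Γ₅ (−½)(1 − γ₀) s = 0`. -/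
theorem fwdHop_zero_mulVec_junkSpinor : fwdHop 0 *ᵥ junkSpinor = 0 := by
  rw [fwdHop, ← Matrix.mulVec_mulVec, Matrix.smul_mulVec, one_sub_euclideanGamma_zero_mulVec_junkSpinor,
    smul_zero, Matrix.mulVec_zero]

/-- At the shared face the two hops into the junk sites add up to `Γ₅ (−½)((1 − γ₁) − (1 − γ₂)) s`, which the
port projector `½(1 − γ₀)` annihilates: `(1 − γ₀) Γ₅ (γ₂ − γ₁) s = Γ₅ (γ₂ − γ₁)(1 − γ₀) s = 0` by anticommutation. -/
theorem portProj_fwdHop_sub_mulVec_junkSpinor :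
    (((1 / 2 : ℂ) • ((1 : Matrix (Fin 4) (Fin 4) ℂ) - euclideanGamma 0)) * (fwdHop 1 - fwdHop 2)) *ᵥ junkSpinor
      = 0 := by
  have h10 : euclideanGamma 1 * euclideanGamma 0 = -(euclideanGamma 0 * euclideanGamma 1) :=
    euclideanGamma_mul_of_ne (by decide)
  have h20 : euclideanGamma 2 * euclideanGamma 0 = -(euclideanGamma 0 * euclideanGamma 2) :=
    euclideanGamma_mul_of_ne (by decide)
  have hg5 : gammaFive * euclideanGamma 0 = -(euclideanGamma 0 * gammaFive) := gammaFive_mul_euclideanGamma 0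
  -- `fwdHop 1 − fwdHop 2 = Γ₅ · ½ (γ₁ − γ₂)`… commute `(1 − γ₀)` through to the right, where it kills `s`
  have hkey : ((1 : Matrix (Fin 4) (Fin 4) ℂ) - euclideanGamma 0) * (fwdHop 1 - fwdHop 2) =
      (gammaFive * ((-(1 / 2 : ℂ)) • (euclideanGamma 2 - euclideanGamma 1))) * (1 - euclideanGamma 0) := by
    simp only [fwdHop]
    rw [← mul_sub, ← smul_sub, sub_sub_sub_cancel_left, mul_smul_comm, mul_smul_comm, smul_mul_assoc,
      ← mul_assoc, sub_mul, one_mul, ← neg_neg (euclideanGamma 0 * gammaFive), ← hg5, sub_neg_eq_add,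
      ← mul_one_add, mul_assoc, mul_assoc]
    congr 2
    rw [add_mul, one_mul, mul_sub, sub_mul, mul_sub, mul_sub, mul_one, mul_one, h10, h20]
    abel
  rw [smul_mul_assoc, Matrix.smul_mulVec, hkey, ← Matrix.mulVec_mulVec,
    one_sub_euclideanGamma_zero_mulVec_junkSpinor, Matrix.mulVec_zero, smul_zero]

/-- `s ≠ 0` (its first entry is `1`). -/
theorem junkSpinor_zero : junkSpinor 0 = 1 := rfl

/-! ### Geometry of the two junk sites and their three faces -/

/-- Equality of sites, coordinatewise. -/
theorem site_eq_iff (y z : Fin 4 → ℤ) : y = z ↔ y 0 = z 0 ∧ y 1 = z 1 ∧ y 2 = z 2 ∧ y 3 = z 3 := by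
  constructor
  · rintro rfl
    exact ⟨rfl, rfl, rfl, rfl⟩
  · rintro ⟨h0, h1, h2, h3⟩
    funext ν
    fin_cases ν <;> assumption

/-- Coordinate `0` of `junkSite₁`. -/
@[simp] theorem junkSite₁_apply_zero (R : ℕ) : junkSite₁ R 0 = R := rfl
/-- Coordinate `1` of `junkSite₁`. -/
@[simp] theorem junkSite₁_apply_one (R : ℕ) : junkSite₁ R 1 = R := rfl
/-- Coordinate `2` of `junkSite₁`. -/
@[simp] theorem junkSite₁_apply_two (R : ℕ) : junkSite₁ R 2 = R - 1 := rfl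
/-- Coordinate `3` of `junkSite₁`. -/
@[simp] theorem junkSite₁_apply_three (R : ℕ) : junkSite₁ R 3 = R - 1 := rfl
/-- Coordinate `0` of `junkSite₂`. -/
@[simp] theorem junkSite₂_apply_zero (R : ℕ) : junkSite₂ R 0 = R := rfl
/-- Coordinate `1` of `junkSite₂`. -/
@[simp] theorem junkSite₂_apply_one (R : ℕ) : junkSite₂ R 1 = R - 1 := rfl
/-- Coordinate `2` of `junkSite₂`. -/
@[simp] theorem junkSite₂_apply_two (R : ℕ) : junkSite₂ R 2 = R := rfl
/-- Coordinate `3` of `junkSite₂`. -/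
@[simp] theorem junkSite₂_apply_three (R : ℕ) : junkSite₂ R 3 = R - 1 := rfl
/-- Coordinate `0` of `junkFace₁`. -/
@[simp] theorem junkFace₁_apply_zero (R : ℕ) : junkFace₁ R 0 = R := rfl
/-- Coordinate `1` of `junkFace₁`. -/
@[simp] theorem junkFace₁_apply_one (R : ℕ) : junkFace₁ R 1 = R - 1 := rfl
/-- Coordinate `2` of `junkFace₁`. -/
@[simp] theorem junkFace₁_apply_two (R : ℕ) : junkFace₁ R 2 = R - 1 := rfl
/-- Coordinate `3` of `junkFace₁`. -/
@[simp] theorem junkFace₁_apply_three (R : ℕ) : junkFace₁ R 3 = R - 1 := rfl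
/-- Coordinate `0` of `junkFace₂`. -/
@[simp] theorem junkFace₂_apply_zero (R : ℕ) : junkFace₂ R 0 = R - 1 := rfl
/-- Coordinate `1` of `junkFace₂`. -/
@[simp] theorem junkFace₂_apply_one (R : ℕ) : junkFace₂ R 1 = R := rfl
/-- Coordinate `2` of `junkFace₂`. -/
@[simp] theorem junkFace₂_apply_two (R : ℕ) : junkFace₂ R 2 = R - 1 := rfl
/-- Coordinate `3` of `junkFace₂`. -/
@[simp] theorem junkFace₂_apply_three (R : ℕ) : junkFace₂ R 3 = R - 1 := rfl
/-- Coordinate `0` of `junkFace₃`. -/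
@[simp] theorem junkFace₃_apply_zero (R : ℕ) : junkFace₃ R 0 = R - 1 := rfl
/-- Coordinate `1` of `junkFace₃`. -/
@[simp] theorem junkFace₃_apply_one (R : ℕ) : junkFace₃ R 1 = R - 1 := rfl
/-- Coordinate `2` of `junkFace₃`. -/
@[simp] theorem junkFace₃_apply_two (R : ℕ) : junkFace₃ R 2 = R := rfl
/-- Coordinate `3` of `junkFace₃`. -/
@[simp] theorem junkFace₃_apply_three (R : ℕ) : junkFace₃ R 3 = R - 1 := rfl

/-- Coordinates of a forward neighbour. -/
theorem add_single_apply (y : Fin 4 → ℤ) (μ ν : Fin 4) :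
    (y + Pi.single μ 1 : Fin 4 → ℤ) ν = y ν + if ν = μ then 1 else 0 := by
  rw [Pi.add_apply, Pi.single_apply]

/-- Coordinates of a backward neighbour. -/
theorem sub_single_apply (y : Fin 4 → ℤ) (μ ν : Fin 4) :
    (y - Pi.single μ 1 : Fin 4 → ℤ) ν = y ν - if ν = μ then 1 else 0 := by
  rw [Pi.sub_apply, Pi.single_apply]

/-- The junk sites lie in the port domain (`R ≥ 1`): in the cube, with exactly the two extreme coordinates `0, 1`
resp. `0, 2`. -/
theorem junkSite_mem_portDomain {R : ℕ} (hR : 1 ≤ R) :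
    junkSite₁ R ∈ portDomain R ∧ junkSite₂ R ∈ portDomain R := by
  have hR' : ((R : ℤ) - 1 ≠ R) ∧ ((R : ℤ) - 1 ≠ -R) := by constructor <;> omega
  have habs : |(R : ℤ) - 1| ≠ R := by
    rw [Ne, abs_eq (by positivity)]; push Not; exact hR'
  constructor
  · refine Finset.mem_filter.mpr ⟨?_, ?_⟩
    · rw [mem_box]; intro ν; fin_cases ν <;> simp <;> omega
    · refine (portRigidity_extremeCount_le {0, 1} fun ν hν => ?_).trans Finset.card_le_two
      fin_cases ν <;> simp_all
  · refine Finset.mem_filter.mpr ⟨?_, ?_⟩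
    · rw [mem_box]; intro ν; fin_cases ν <;> simp <;> omega
    · refine (portRigidity_extremeCount_le {0, 2} fun ν hν => ?_).trans Finset.card_le_two
      fin_cases ν <;> simp_all

/-- No link joins two junk sites: a forward neighbour of a junk site is not a junk site. -/
theorem not_isJunkSite_add_single {R : ℕ} {y : Fin 4 → ℤ} (hy : IsJunkSite R y) (μ : Fin 4) :
    ¬ IsJunkSite R (y + Pi.single μ 1) := by
  rintro (h | h) <;> rcases hy with hy | hy <;>
    · rw [site_eq_iff] at h hy
      simp only [add_single_apply] at h
      fin_cases μ <;> simp at h hy <;> omega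

/-- A site of the interior cube `box 4 (R−1)` is not a junk site, nor is any of its neighbours (every neighbour of
a junk site keeps a coordinate equal to `R`). -/
theorem not_isJunkSite_of_mem_box {R : ℕ} (hR : 1 ≤ R) {y : Fin 4 → ℤ} (hy : y ∈ box 4 (R - 1)) (μ : Fin 4) :
    ¬ IsJunkSite R y ∧ ¬ IsJunkSite R (y + Pi.single μ 1) ∧ ¬ IsJunkSite R (y - Pi.single μ 1) := by
  rw [mem_box] at hy
  have h0 := hy 0; have h1 := hy 1; have h2 := hy 2
  have hc : ((R - 1 : ℕ) : ℤ) = (R : ℤ) - 1 := by push_cast [Nat.cast_sub hR]; ring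
  rw [hc] at h0 h1 h2
  refine ⟨?_, ?_, ?_⟩
  · rintro (h | h) <;>
      · rw [site_eq_iff] at h; simp at h; omega
  · rintro (h | h) <;>
      · rw [site_eq_iff] at h; simp only [add_single_apply] at h
        fin_cases μ <;> simp at h <;> omega
  · rintro (h | h) <;>
      · rw [site_eq_iff] at h; simp only [sub_single_apply] at h
        fin_cases μ <;> simp at h <;> omega

/-- A face is not a junk site, no backward neighbour of a face is a junk site, and the forward neighbours that are
junk sites are exactly `f₂ + e₀ = z₁`, `f₁ + e₁ = z₁`, `f₃ + e₀ = z₂`, `f₁ + e₂ = z₂`. -/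
theorem face_junk_geometry {R : ℕ} (hR : 1 ≤ R) {y : Fin 4 → ℤ} (hy : y ∈ portFaces R) :
    ¬ IsJunkSite R y ∧ (∀ μ, ¬ IsJunkSite R (y - Pi.single μ 1)) ∧
      (∀ μ : Fin 4, y + Pi.single μ 1 = junkSite₁ R → (μ = 0 ∧ y = junkFace₂ R) ∨ (μ = 1 ∧ y = junkFace₁ R)) ∧
      (∀ μ : Fin 4, y + Pi.single μ 1 = junkSite₂ R → (μ = 0 ∧ y = junkFace₃ R) ∨ (μ = 2 ∧ y = junkFace₁ R)) := by
  obtain ⟨hyb, μ₀, hμ₀⟩ := portRigidity_face hy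
  rw [mem_box] at hyb
  have h0 := hyb 0; have h1 := hyb 1; have h2 := hyb 2; have h3 := hyb 3
  -- turn the `|y ν| = R ↔ ν = μ₀` data into linear-arithmetic facts
  have habs : ∀ ν, (y ν = R ∨ y ν = -R) ↔ ν = μ₀ := fun ν => by
    rw [← hμ₀ ν, abs_eq (by positivity)]
  have e0 := habs 0; have e1 := habs 1; have e2 := habs 2; have e3 := habs 3
  refine ⟨?_, ?_, ?_, ?_⟩
  · rintro (h | h) <;>
      · rw [site_eq_iff] at h; simp at h
        fin_cases μ₀ <;> simp at e0 e1 e2 e3 <;> omega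
  · rintro μ (h | h) <;>
      · rw [site_eq_iff] at h; simp only [sub_single_apply] at h
        fin_cases μ <;> simp at h <;> fin_cases μ₀ <;> simp at e0 e1 e2 e3 <;> omega
  · intro μ h
    rw [site_eq_iff] at h; simp only [add_single_apply] at h
    fin_cases μ <;> simp at h ⊢
    · rw [site_eq_iff]; simp; omega
    · rw [site_eq_iff]; simp; omega
    · fin_cases μ₀ <;> simp at e0 e1 e2 e3 <;> omega
    · fin_cases μ₀ <;> simp at e0 e1 e2 e3 <;> omega
  · intro μ h
    rw [site_eq_iff] at h; simp only [add_single_apply] at h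
    fin_cases μ <;> simp at h ⊢
    · rw [site_eq_iff]; simp; omega
    · fin_cases μ₀ <;> simp at e0 e1 e2 e3 <;> omega
    · rw [site_eq_iff]; simp; omega
    · fin_cases μ₀ <;> simp at e0 e1 e2 e3 <;> omega

/-- The faces `f₁, f₂, f₃` are pairwise distinct and have extreme coordinate `0`, `1`, `2` respectively; their
forward junk neighbours. -/
theorem junkFace_facts (R : ℕ) :
    junkFace₁ R 0 = R ∧ junkFace₂ R 1 = R ∧ junkFace₃ R 2 = R ∧
      junkFace₁ R ≠ junkFace₂ R ∧ junkFace₁ R ≠ junkFace₃ R ∧ junkFace₂ R ≠ junkFace₃ R ∧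
      junkFace₁ R + Pi.single 1 1 = junkSite₁ R ∧ junkFace₁ R + Pi.single 2 1 = junkSite₂ R ∧
      junkFace₂ R + Pi.single 0 1 = junkSite₁ R ∧ junkFace₃ R + Pi.single 0 1 = junkSite₂ R := by
  refine ⟨rfl, rfl, rfl, ?_, ?_, ?_, ?_, ?_, ?_, ?_⟩
  · intro h; have := congrFun h 0; simp at this; omega
  · intro h; have := congrFun h 0; simp at this; omega
  · intro h; have := congrFun h 1; simp at this; omega
  all_goals
    rw [site_eq_iff]; simp only [add_single_apply]; simp


/-! ### Product fields: the hop sum and the current factorise -/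

/-- For a field of product form `v(y) = col(y) ⊗ s`, the Hermitian Wilson–Dirac hop sum factorises direction by
direction into (colour transport of the neighbour's amplitude) × (hop block applied to `s`). -/
theorem latticeApply_productField (m₀ : ℝ) (w : LinkData) (col : (Fin 4 → ℤ) → Fin 3 → ℂ) (s : Fin 4 → ℂ)
    (y : Fin 4 → ℤ) (a : Fin 3) (β : Fin 4) :
    latticeApply m₀ w (fun y' b β' => col y' b * s β') y a β =
      ((m₀ + 4 : ℝ) : ℂ) * (col y a * (gammaFive *ᵥ s) β) +
        ∑ μ : Fin 4,
          ((((w (y, μ) : SU3) : Matrix (Fin 3) (Fin 3) ℂ) *ᵥ col (y + Pi.single μ 1)) a * (fwdHop μ *ᵥ s) β +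
            ((((w (y - Pi.single μ 1, μ))⁻¹ : SU3) : Matrix (Fin 3) (Fin 3) ℂ) *ᵥ col (y - Pi.single μ 1)) a *
              (bwdHop μ *ᵥ s) β) := by
  simp only [latticeApply, Matrix.mulVec, dotProduct]
  congr 1
  · simp only [Finset.mul_sum]
    exact Finset.sum_congr rfl fun γ _ => by ring
  · refine Finset.sum_congr rfl fun μ _ => ?_
    rw [Finset.sum_mul_sum, Finset.sum_mul_sum, ← Finset.sum_add_distrib]
    refine Finset.sum_congr rfl fun b _ => ?_
    rw [← Finset.sum_add_distrib]
    refine Finset.sum_congr rfl fun β' _ => by ring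

/-- For a field of product form, the colour current through a link vanishes as soon as the colour amplitude
vanishes at one of its two endpoints. -/
theorem latticeCurrent_productField_eq_zero (w : LinkData) (col : (Fin 4 → ℤ) → Fin 3 → ℂ) (s : Fin 4 → ℂ)
    (y : Fin 4 → ℤ) (μ : Fin 4) (i : Fin 8) (h : col y = 0 ∨ col (y + Pi.single μ 1) = 0) :
    latticeCurrent w (fun y' b β' => col y' b * s β') y μ i = 0 := by
  simp only [latticeCurrent]
  have hz : ∀ a b α β, star (col y a * s α) * fwdHop μ α β *
      (((w (y, μ) : SU3) : Matrix (Fin 3) (Fin 3) ℂ) * su3Basis i) a b * (col (y + Pi.single μ 1) b * s β) = 0 := by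
    intro a b α β
    rcases h with h | h
    · rw [h]; simp
    · rw [h]; simp
  simp only [hz, Finset.sum_const_zero, Complex.zero_re, mul_zero]

end Summit.QuantumFields.QCD.Cruxes.WegnerEstimate.ResolventCell

end
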